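import Mathlib
import HarnessLib

/-!
# ValiantsHypothesis / LacunarySymmetroid — crux `MatrixDescartes` (stmt-ValiantsHypothesis-18050, V1),
# line `Cruxes/MatrixDescartes/Lines/osculation_law.lean` («osculation-law»), stub `stub_recursion`:
# R3 — INVARIANCES OF THE POSITIVE-ROOT COUNT OF A PENCIL DETERMINANT (congruence, sign, adding a letter)

Helper algebra for the `K`-induction of `stub_recursion` (val-lit-p8 g12's SPEC
`HOME/lmr/SPEC-p8g12-18050-stub_recursion-R3R5.md`, desk RULINGS #283/#284; R1/R2 = p8's `…RecursionSplit`,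
R6 = the general-position residue).  For a block pencil `pencil d S = Σ_l X^{d l} • (S l).map C` over `ℝ[X]`:
* `pencil_congr`, `det_pencil_congr`, `card_posRoots_det_pencil_congr` — congruence `S_l ↦ Wᵀ S_l W` multiplies the
  determinant by `C (det W)²` and (for `det W ≠ 0`) keeps the positive roots, with multiplicity;
* `pencil_neg`, `det_pencil_neg`, `card_posRoots_det_neg` — `S_l ↦ −S_l` multiplies the determinant by `(−1)^{#ι}`;
* `pencil_snoc` — appending a letter `T` at exponent `N` adds `X^N • T.map C`;
* `det_insert_gram`, `det_insert_gram_sub` — inserting a letter `YᵀY − c•1` (`W Y = 1`): the Gram part is the FULL-RANK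
  projector after the congruence by `W`, the scalar part is the full-rank projector inserted into the NEGATED pencil;
* `isSymm_congr`, `fromBlocks_one_sum_fin_zero`, `det_toBlocks₂₂_pencil_fin_zero`, `card_posRoots_det_pencil_fin_zero`
  — symmetry and the `(m, 0)` splitting bookkeeping (`I_m ⊕ 0 = 1`, `det G₂₂ = 1`, no letters ⇒ no positive roots).
Honest framing: algebraic bookkeeping toward the OPEN stub `stub_recursion`; the osculation LAW, `MatrixDescartes`,
Conjecture B and `VP ≠ VNP` are NOT proved.  No definitions, no named facts.  (val-lit-p4 g13, helper
`--supports stmt-ValiantsHypothesis-18050`.)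
-/

-- `Summit.ValiantsHypothesis.ValiantsHypothesis.…` is the tree's mandated single-conjunct layout (Sub = Summit).
set_option linter.dupNamespace false

noncomputable section

namespace Summit.ValiantsHypothesis.ValiantsHypothesis.Theorems.LacunarySymmetroidMatrixDescartes

open Polynomial
open scoped BigOperators Matrix

namespace OsculationRecursion

variable {ι : Type*} [Fintype ι] [DecidableEq ι] {K : ℕ}

/-! ### Congruence -/

omit [DecidableEq ι] in
/-- Congruence of every letter is congruence of the pencil (over `ℝ[X]`). [folklore] -/
theorem pencil_congr (W : Matrix ι ι ℝ) (d : Fin K → ℕ) (S : Fin K → Matrix ι ι ℝ) :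
    (∑ l, (X : ℝ[X]) ^ d l • (Wᵀ * S l * W).map Polynomial.C) =
      (W.map Polynomial.C)ᵀ * (∑ l, (X : ℝ[X]) ^ d l • (S l).map Polynomial.C) * W.map Polynomial.C := by
  rw [Finset.mul_sum, Finset.sum_mul]
  refine Finset.sum_congr rfl fun l _ => ?_
  rw [Matrix.map_mul, Matrix.map_mul, Matrix.transpose_map, Matrix.mul_smul, Matrix.smul_mul]

/-- **Congruence multiplies the pencil determinant by `C (det W)²`.** [folklore] -/
theorem det_pencil_congr (W : Matrix ι ι ℝ) (d : Fin K → ℕ) (S : Fin K → Matrix ι ι ℝ) :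
    (∑ l, (X : ℝ[X]) ^ d l • (Wᵀ * S l * W).map Polynomial.C).det =
      Polynomial.C (W.det ^ 2) * (∑ l, (X : ℝ[X]) ^ d l • (S l).map Polynomial.C).det := by
  rw [pencil_congr, Matrix.det_mul, Matrix.det_mul, Matrix.det_transpose, ← RingHom.mapMatrix_apply,
    ← RingHom.map_det, map_pow]
  ring

/-- Multiplying by a non-zero constant keeps the positive roots (with multiplicity). [folklore] -/
theorem card_posRoots_C_mul (a : ℝ) (ha : a ≠ 0) (p : ℝ[X]) :
    Multiset.card ((Polynomial.C a * p).roots.filter (fun t => 0 < t)) =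
      Multiset.card (p.roots.filter (fun t => 0 < t)) := by
  rw [roots_C_mul _ ha]

/-- **Congruence by an invertible `W` keeps the positive roots of the pencil determinant** (with multiplicity).
[folklore] -/
theorem card_posRoots_det_pencil_congr (W : Matrix ι ι ℝ) (hW : W.det ≠ 0) (d : Fin K → ℕ)
    (S : Fin K → Matrix ι ι ℝ) :
    Multiset.card ((∑ l, (X : ℝ[X]) ^ d l • (Wᵀ * S l * W).map Polynomial.C).det.roots.filter (fun t => 0 < t)) =
      Multiset.card ((∑ l, (X : ℝ[X]) ^ d l • (S l).map Polynomial.C).det.roots.filter (fun t => 0 < t)) := by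
  rw [det_pencil_congr, card_posRoots_C_mul _ (pow_ne_zero 2 hW)]

/-! ### Sign -/

omit [Fintype ι] [DecidableEq ι] in
/-- Negating every letter negates the pencil. [folklore] -/
theorem pencil_neg (d : Fin K → ℕ) (S : Fin K → Matrix ι ι ℝ) :
    (∑ l, (X : ℝ[X]) ^ d l • (-S l).map Polynomial.C) = -(∑ l, (X : ℝ[X]) ^ d l • (S l).map Polynomial.C) := by
  rw [← Finset.sum_neg_distrib]
  refine Finset.sum_congr rfl fun l _ => ?_
  rw [Matrix.map_neg _ (map_neg Polynomial.C), smul_neg]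

/-- `det(−M) = (−1)^{#ι} det M` for the pencil. [folklore] -/
theorem det_pencil_neg (d : Fin K → ℕ) (S : Fin K → Matrix ι ι ℝ) :
    (∑ l, (X : ℝ[X]) ^ d l • (-S l).map Polynomial.C).det =
      (-1) ^ Fintype.card ι * (∑ l, (X : ℝ[X]) ^ d l • (S l).map Polynomial.C).det := by
  rw [pencil_neg, Matrix.det_neg]

/-- Multiplying by `(−1)^n` keeps the positive roots (with multiplicity). [folklore] -/
theorem card_posRoots_neg_one_pow_mul (n : ℕ) (p : ℝ[X]) :
    Multiset.card ((((-1 : ℝ[X]) ^ n) * p).roots.filter (fun t => 0 < t)) =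
      Multiset.card (p.roots.filter (fun t => 0 < t)) := by
  rcases neg_one_pow_eq_or ℝ[X] n with h | h
  · rw [h, one_mul]
  · rw [h, neg_one_mul, roots_neg]

/-- `det(−A)` has the same positive roots as `det A`. [folklore] -/
theorem card_posRoots_det_neg (A : Matrix ι ι ℝ[X]) :
    Multiset.card ((-A).det.roots.filter (fun t => 0 < t)) = Multiset.card (A.det.roots.filter (fun t => 0 < t)) := by
  rw [Matrix.det_neg, card_posRoots_neg_one_pow_mul]

/-! ### Adding a letter -/

omit [Fintype ι] [DecidableEq ι] in
/-- **Appending a letter** `T` at exponent `N`: the pencil of `(snoc d N, snoc S T)` is `pencil d S + X^N • T`.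
[folklore] -/
theorem pencil_snoc (d : Fin K → ℕ) (S : Fin K → Matrix ι ι ℝ) (N : ℕ) (T : Matrix ι ι ℝ) :
    (∑ l, (X : ℝ[X]) ^ (Fin.snoc d N : Fin (K + 1) → ℕ) l • ((Fin.snoc S T : Fin (K + 1) → Matrix ι ι ℝ) l).map Polynomial.C) =
      (∑ l, (X : ℝ[X]) ^ d l • (S l).map Polynomial.C) + (X : ℝ[X]) ^ N • T.map Polynomial.C := by
  rw [Fin.sum_univ_castSucc]
  simp only [Fin.snoc_castSucc, Fin.snoc_last]

/-- **Inserting a Gram letter** `YᵀY` at exponent `N`, with `W Y = 1`: up to the congruence by `Y`, it is the identity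
letter inserted into the `W`-congruent pencil,
`det(G + X^N·YᵀY) = C(det Y)² · det(Wᵀ G W + X^N·1)`. [folklore] -/
theorem det_insert_gram (d : Fin K → ℕ) (S : Fin K → Matrix ι ι ℝ) (N : ℕ) (Y W : Matrix ι ι ℝ) (hWY : W * Y = 1) :
    ((∑ l, (X : ℝ[X]) ^ d l • (S l).map Polynomial.C) + (X : ℝ[X]) ^ N • (Yᵀ * Y).map Polynomial.C).det =
      Polynomial.C (Y.det ^ 2) *
        ((∑ l, (X : ℝ[X]) ^ d l • (Wᵀ * S l * W).map Polynomial.C) +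
          (X : ℝ[X]) ^ N • (1 : Matrix ι ι ℝ).map Polynomial.C).det := by
  -- undo the congruence: `Yᵀ (Wᵀ S W) Y = S`, `Yᵀ 1 Y = YᵀY`
  have h1 : ∀ l, Yᵀ * (Wᵀ * S l * W) * Y = S l := by
    intro l
    calc Yᵀ * (Wᵀ * S l * W) * Y = (W * Y)ᵀ * S l * (W * Y) := by
          rw [Matrix.transpose_mul]; simp only [Matrix.mul_assoc]
      _ = S l := by rw [hWY, Matrix.transpose_one, Matrix.one_mul, Matrix.mul_one]
  have hp : (∑ l, (X : ℝ[X]) ^ d l • (S l).map Polynomial.C) =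
      (Y.map Polynomial.C)ᵀ * (∑ l, (X : ℝ[X]) ^ d l • (Wᵀ * S l * W).map Polynomial.C) * Y.map Polynomial.C := by
    have h := pencil_congr Y d (fun l => Wᵀ * S l * W)
    simp only [h1] at h
    exact h
  have hq : (X : ℝ[X]) ^ N • (Yᵀ * Y).map Polynomial.C =
      (Y.map Polynomial.C)ᵀ * ((X : ℝ[X]) ^ N • (1 : Matrix ι ι ℝ).map Polynomial.C) * Y.map Polynomial.C := by
    rw [Matrix.map_one _ (map_zero _) (map_one _), Matrix.mul_smul, Matrix.mul_one, Matrix.smul_mul,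
      Matrix.map_mul, Matrix.transpose_map]
  rw [hp, hq, ← Matrix.add_mul, ← Matrix.mul_add, Matrix.det_mul, Matrix.det_mul, Matrix.det_transpose,
    ← RingHom.mapMatrix_apply, ← RingHom.map_det, map_pow]
  ring

/-- **Inserting `YᵀY − c•1`** (val-lit-p8 g12's `exists_gram_sub_smul_one` split of a symmetric letter): the scalar
part is the identity letter with scale `c` inserted into the NEGATED extended pencil,
`det(G + X^N·(YᵀY − c·1)) = (−1)^{#ι} · det( (−G − X^N·YᵀY) + (c X^N)·1 )`, and `−G − X^N·YᵀY` is the pencil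
with letters `snoc (−S) (−YᵀY)` and exponents `snoc d N`. [folklore] -/
theorem det_insert_gram_sub (d : Fin K → ℕ) (S : Fin K → Matrix ι ι ℝ) (N : ℕ) (Y : Matrix ι ι ℝ) (c : ℝ) :
    ((∑ l, (X : ℝ[X]) ^ d l • (S l).map Polynomial.C) + (X : ℝ[X]) ^ N • (Yᵀ * Y - c • (1 : Matrix ι ι ℝ)).map Polynomial.C).det =
      (-1) ^ Fintype.card ι *
        ((∑ l, (X : ℝ[X]) ^ (Fin.snoc d N : Fin (K + 1) → ℕ) l •
            ((Fin.snoc (fun l => -S l) (-(Yᵀ * Y)) : Fin (K + 1) → Matrix ι ι ℝ) l).map Polynomial.C) +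
          (Polynomial.C c * (X : ℝ[X]) ^ N) • (1 : Matrix ι ι ℝ).map Polynomial.C).det := by
  have hM : (∑ l, (X : ℝ[X]) ^ d l • (S l).map Polynomial.C) + (X : ℝ[X]) ^ N • (Yᵀ * Y - c • (1 : Matrix ι ι ℝ)).map Polynomial.C =
      -((∑ l, (X : ℝ[X]) ^ (Fin.snoc d N : Fin (K + 1) → ℕ) l •
            ((Fin.snoc (fun l => -S l) (-(Yᵀ * Y)) : Fin (K + 1) → Matrix ι ι ℝ) l).map Polynomial.C) +
          (Polynomial.C c * (X : ℝ[X]) ^ N) • (1 : Matrix ι ι ℝ).map Polynomial.C) := by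
    rw [pencil_snoc, pencil_neg]
    refine Matrix.ext fun i j => ?_
    by_cases hij : i = j
    · subst hij
      simp
      ring
    · simp [hij]
      ring
  rw [hM, Matrix.det_neg]

/-! ### Symmetry and the `(m, 0)` splitting -/

omit [DecidableEq ι] in
/-- Congruence preserves symmetry. [folklore] -/
theorem isSymm_congr {S : Matrix ι ι ℝ} (hS : S.IsSymm) (W : Matrix ι ι ℝ) : (Wᵀ * S * W).IsSymm := by
  unfold Matrix.IsSymm at hS ⊢
  rw [Matrix.transpose_mul, Matrix.transpose_mul, Matrix.transpose_transpose, hS, Matrix.mul_assoc]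

/-- On `Fin m ⊕ Fin 0` the full-rank block projector is the identity: `I_m ⊕ 0 = 1`. [folklore] -/
theorem fromBlocks_one_sum_fin_zero (m : ℕ) :
    (Matrix.fromBlocks 1 0 0 0 : Matrix (Fin m ⊕ Fin 0) (Fin m ⊕ Fin 0) ℝ) = 1 := by
  rw [show (0 : Matrix (Fin 0) (Fin 0) ℝ) = 1 from Subsingleton.elim _ _, Matrix.fromBlocks_one]

/-- On `Fin m ⊕ Fin 0` the lower block is empty: `det G₂₂ = 1`. [folklore] -/
theorem det_toBlocks₂₂_pencil_fin_zero (m : ℕ) (d : Fin K → ℕ)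
    (S : Fin K → Matrix (Fin m ⊕ Fin 0) (Fin m ⊕ Fin 0) ℝ) :
    (∑ l, (X : ℝ[X]) ^ d l • ((S l).toBlocks₂₂).map Polynomial.C).det = 1 :=
  Matrix.det_isEmpty

/-- The empty pencil has no positive roots. [folklore] -/
theorem card_posRoots_det_pencil_fin_zero (d : Fin 0 → ℕ) (S : Fin 0 → Matrix ι ι ℝ) :
    Multiset.card ((∑ l, (X : ℝ[X]) ^ d l • (S l).map Polynomial.C).det.roots.filter (fun t => 0 < t)) = 0 := by
  rw [Finset.univ_eq_empty, Finset.sum_empty]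
  cases isEmpty_or_nonempty ι with
  | inl h => rw [Matrix.det_isEmpty, roots_one]; rfl
  | inr h => rw [Matrix.det_zero, roots_zero]; rfl

end OsculationRecursion

end Summit.ValiantsHypothesis.ValiantsHypothesis.Theorems.LacunarySymmetroidMatrixDescartes

end
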